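import Mathlib
import Summits.PneNP.PneNP.Theses.OverlapGapAlgebra
import Summits.PneNP.PneNP.Theorems.OverlapGapAlgebraSolvableImpliesStableSectionMeanSquareFromMeanFilter
import Summits.PneNP.PneNP.Theorems.OverlapGapAlgebraSolvableImpliesStableSectionFilteredRepairLocal
import Summits.PneNP.PneNP.Theorems.OverlapGapAlgebraSolvableImpliesStableSectionFilteredRepairMean
import Summits.PneNP.PneNP.Theorems.OverlapGapAlgebraSolvableImpliesStableSectionFilteredRepairRates
import Summits.PneNP.PneNP.Theorems.OverlapGapAlgebraSolvableImpliesStableSectionUnitClauseCore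

/-!
# PneNP / OverlapGapAlgebra — crux `SolvableImpliesStableSection` (stmt-PneNP-2463):
# the FILTERED REPAIR block (7/7) — assembly: the conclusion for `ν > 2^{-k}(1 - e^{-λ}/2)` and the new core

Support for crux `stmt-PneNP-2463` (`Summit.PneNP.PneNP.Theses.OverlapGapAlgebra.SolvableImpliesStableSection`).
THE RESULT OF THE BLOCK.  For every `k ≥ 2`, EVERY density `α > 0`, every `η > 0`, `c > 0` and every
`ν > 2^{-k}(1 - e^{-λ}/2)` (`λ = kα2^{-k}`), the conclusion of the crux at `(k, α, η, ν)` holds outright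
for all large `n` (`sissF_conclusion`): the section is ONE ROUND OF FILTERED REPAIR (flip the first
variable of each all-positive clause unless some clause is critical for it), a radius-`0` local rule
(`sissF_local`) whose mean violation per clause is eventually `≤ 2^{-k}(1 - e^{-λ}/2)` (`sissF_count_viol_le`,
`sissF_mean_le_of_count`, `sissF_rates`), so the local-rule engine `sissMV_concl_of_localMean` applies.
This is the first f-free piece of the crux valid at every density — in particular inside the
Bresler–Huang window and at the boundary `ν = 2^{-k}` — and it shrinks the core of the crux
(`sissF_solvableImpliesStableSection_iff_core`): the crux is equivalent to its restriction to
`{α ≥ α_UC(k)} ∩ {α < 2^k log 2} ∩ {η < 1} ∩ {ν ≤ 2^{-k} min(1 - e^{-λ}/2, e^{λ} - 1)}`.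

* `sissF_conclusion` — the conclusion of the crux above the filtered-repair level, unconditionally;
* `sissF_solvableImpliesStableSection_off_core`, `sissF_solvableImpliesStableSection_iff_core`.
No new definitions; axioms `propext`, `Classical.choice`, `Quot.sound`.
-/

set_option linter.dupNamespace false -- `Summit.PneNP.PneNP.…`: summit = sub-problem (D-0017)

namespace Summit.PneNP.PneNP.Theorems

open Finset Filter
open scoped Classical

section FilteredRepairAssembly

/-- **The conclusion of the crux above the filtered-repair level, unconditionally.** For every
`k ≥ 2`, `α, η > 0`, `ν > 2^{-k}(1 - e^{-kα2^{-k}}/2)` and `c > 0`, for all large `n` (`m = ⌊α n⌋₊`) some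
map (one round of filtered repair) is `νm`-valid at every splice point of the Bresler–Huang path and
moves by at most `η n` between consecutive splice points, on at least `e^{-cn}·#paths` of the path
tuples. -/
theorem sissF_conclusion (k : ℕ) (hk2 : 2 ≤ k) (α η ν : ℝ) (hα : 0 < α) (hη : 0 < η)
    (hν : (1 / 2 : ℝ) ^ k * (1 - Real.exp (-(k * α * (1 / 2 : ℝ) ^ k)) / 2) < ν) (c : ℝ) (hc : 0 < c) :
    ∀ᶠ n : ℕ in Filter.atTop, ∀ m : ℕ, m = ⌊α * n⌋₊ →
      ∃ g : (Fin m → Fin k → Fin n × Bool) → (Fin n → Bool),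
        Real.exp (-(c * n)) * Fintype.card (Fin (k + 1) → Fin m → Fin k → Fin n × Bool) ≤
        ((Finset.univ.filter fun Ψ : Fin (k + 1) → Fin m → Fin k → Fin n × Bool =>
          let P : Fin k → ℕ → Fin m → Fin k → Fin n × Bool :=
            fun r q a b => if (a : ℕ) * k + b < q then Ψ r.succ a b else Ψ r.castSucc a b
          (∀ r : Fin k, ∀ q ≤ m * k, ((Finset.univ.filter fun i : Fin m =>
            ∀ j, g (P r q) (P r q i j).1 ≠ (P r q i j).2).card : ℝ) ≤ ν * m) ∧
          ∀ r : Fin k, ∀ q < m * k,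
            (hammingDist (g (P r q)) (g (P r (q + 1))) : ℝ) ≤ η * n).card : ℝ) := by
  have hk1 : 1 ≤ k := by omega
  have hk0 : 0 < k := by omega
  set μ : ℝ := (1 / 2 : ℝ) ^ k * (1 - Real.exp (-(k * α * (1 / 2 : ℝ) ^ k)) / 2) with hμ
  refine sissMV_concl_of_localMean k 0 hk1 α η ν μ hα hη hν ?_ c hc
  filter_upwards [sissF_rates k hk2 α hα, eventually_ge_atTop 1] with n hrate hn1 m hm
  obtain ⟨hkm, hq⟩ := hrate m hm
  -- the filtered repair map, opaque: only its specification is used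
  obtain ⟨g, hg⟩ : ∃ g : (Fin m → Fin k → Fin n × Bool) → (Fin n → Bool),
      ∀ (Φ : Fin m → Fin k → Fin n × Bool) (v : Fin n),
        g Φ v = true ↔ (∃ a : Fin m, (Φ a ⟨0, hk0⟩).1 = v ∧ ∀ j, (Φ a j).2 = true) ∧
          ¬ ∃ a : Fin m, (∃ j, (Φ a j).2 = false) ∧ ∀ j, (Φ a j).2 = false → (Φ a j).1 = v :=
    ⟨fun Φ v => decide ((∃ a : Fin m, (Φ a ⟨0, hk0⟩).1 = v ∧ ∀ j, (Φ a j).2 = true) ∧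
        ¬ ∃ a : Fin m, (∃ j, (Φ a j).2 = false) ∧ ∀ j, (Φ a j).2 = false → (Φ a j).1 = v),
      fun Φ v => by simp only [decide_eq_true_eq]⟩
  refine ⟨g, ?_, ?_⟩
  · -- radius-0 locality
    intro Φ Φ' v H
    refine sissF_local hk0 g hg Φ Φ' v fun i hi => H i ?_
    rcases hi with ⟨j, hj⟩ | ⟨j, hj⟩
    · exact Or.inl ⟨j, fun _ => v, rfl, hj.symm, fun s hs => absurd hs (Nat.not_lt_zero s)⟩
    · exact Or.inr ⟨j, fun _ => v, rfl, hj.symm, fun s hs => absurd hs (Nat.not_lt_zero s)⟩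
  · -- the mean bound, clause by clause
    set N : ℝ := (Fintype.card (Fin m → Fin k → Fin n × Bool) : ℝ) with hN
    have hN0 : 0 ≤ N := Nat.cast_nonneg _
    have hper : ∀ i : Fin m, ((((univ : Finset (Fin m → Fin k → Fin n × Bool)).filter fun Φ =>
        ∀ j, g Φ (Φ i j).1 ≠ (Φ i j).2).card : ℕ) : ℝ) ≤ N * μ := by
      intro i
      have hcnt := sissF_count_viol_le hk0 hk2 g hg i
      have h := sissF_mean_le_of_count (k := k) (m := m) (n := n) hk1 hn1 hkm _
        ((2 * n) ^ k - k * (n + 1) ^ (k - 1)) (fun t => (2 * n) ^ k - t * (k * n ^ (k - 1)))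
        (Nat.sub_le _ _) hcnt
      exact h.trans (mul_le_mul_of_nonneg_left hq hN0)
    calc ∑ Φ : Fin m → Fin k → Fin n × Bool,
          ((((univ : Finset (Fin m)).filter fun i => ∀ j, g Φ (Φ i j).1 ≠ (Φ i j).2).card : ℕ) : ℝ)
        = ∑ Φ : Fin m → Fin k → Fin n × Bool, ∑ i : Fin m,
            (if ∀ j, g Φ (Φ i j).1 ≠ (Φ i j).2 then (1 : ℝ) else 0) := by
          refine sum_congr rfl fun Φ _ => ?_
          rw [natCast_card_filter]
      _ = ∑ i : Fin m, ∑ Φ : Fin m → Fin k → Fin n × Bool,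
            (if ∀ j, g Φ (Φ i j).1 ≠ (Φ i j).2 then (1 : ℝ) else 0) := sum_comm
      _ = ∑ i : Fin m, ((((univ : Finset (Fin m → Fin k → Fin n × Bool)).filter fun Φ =>
            ∀ j, g Φ (Φ i j).1 ≠ (Φ i j).2).card : ℕ) : ℝ) := by
          refine sum_congr rfl fun i _ => ?_
          rw [natCast_card_filter]
      _ ≤ ∑ _i : Fin m, N * μ := sum_le_sum fun i _ => hper i
      _ = μ * m * N := by
          rw [sum_const, card_univ, Fintype.card_fin, nsmul_eq_mul]; ring


/-- **In particular at the trivial level.** For every `k ≥ 2`, `α, η > 0`, `ν ≥ 2^{-k}` and `c > 0` the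
conclusion of the crux at `(k, α, η, ν)` holds for all large `n` — the boundary case `ν = 2^{-k}` left open
by the constant section (`conclusion_const_section` needs `ν > 2^{-k}`). -/
theorem sissF_conclusion_of_trivial_level (k : ℕ) (hk2 : 2 ≤ k) (α η ν : ℝ) (hα : 0 < α) (hη : 0 < η)
    (hν : (1 / 2 : ℝ) ^ k ≤ ν) (c : ℝ) (hc : 0 < c) :
    ∀ᶠ n : ℕ in Filter.atTop, ∀ m : ℕ, m = ⌊α * n⌋₊ →
      ∃ g : (Fin m → Fin k → Fin n × Bool) → (Fin n → Bool),
        Real.exp (-(c * n)) * Fintype.card (Fin (k + 1) → Fin m → Fin k → Fin n × Bool) ≤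
        ((Finset.univ.filter fun Ψ : Fin (k + 1) → Fin m → Fin k → Fin n × Bool =>
          let P : Fin k → ℕ → Fin m → Fin k → Fin n × Bool :=
            fun r q a b => if (a : ℕ) * k + b < q then Ψ r.succ a b else Ψ r.castSucc a b
          (∀ r : Fin k, ∀ q ≤ m * k, ((Finset.univ.filter fun i : Fin m =>
            ∀ j, g (P r q) (P r q i j).1 ≠ (P r q i j).2).card : ℝ) ≤ ν * m) ∧
          ∀ r : Fin k, ∀ q < m * k,
            (hammingDist (g (P r q)) (g (P r (q + 1))) : ℝ) ≤ η * n).card : ℝ) := by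
  refine sissF_conclusion k hk2 α η ν hα hη ?_ c hc
  have hpos : 0 < Real.exp (-(k * α * (1 / 2 : ℝ) ^ k)) := Real.exp_pos _
  have hc0 : (0 : ℝ) < (1 / 2 : ℝ) ^ k := by positivity
  have : (1 / 2 : ℝ) ^ k * (1 - Real.exp (-(k * α * (1 / 2 : ℝ) ^ k)) / 2) < (1 / 2 : ℝ) ^ k * 1 :=
    mul_lt_mul_of_pos_left (by linarith) hc0
  linarith

/-- **The crux off the new core region.** For every `k ≥ 3` and `α, η, ν > 0` with `α` below the
unit-clause threshold (`α·(k²-k)·2M_k < 2^k`), or `α ≥ 2^k log 2`, or `η ≥ 1`, or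
`ν > 2^{-k}(1 - e^{-kα2^{-k}}/2)`, or `ν > 2^{-k}(e^{kα2^{-k}} - 1)`, the implication of
`SolvableImpliesStableSection` at `(k, α, η, ν)` holds. -/
theorem sissF_solvableImpliesStableSection_off_core (k : ℕ) (hk : 3 ≤ k) (α η ν : ℝ) (hα : 0 < α)
    (hη : 0 < η) (hν : 0 < ν)
    (hoff : α * ((k * k - k : ℕ) : ℝ) * (2 * (((k : ℝ) - 2) ^ (k - 2) / ((k : ℝ) - 1) ^ (k - 1))) < (2 : ℝ) ^ k ∨
      (2 : ℝ) ^ k * Real.log 2 ≤ α ∨ 1 ≤ η ∨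
      (1 / 2 : ℝ) ^ k * (1 - Real.exp (-(k * α * (1 / 2 : ℝ) ^ k)) / 2) < ν ∨
      (1 / 2 : ℝ) ^ k * (Real.exp (k * α * (1 / 2 : ℝ) ^ k) - 1) < ν)
    (hsolv : ∃ f : List Bool → List Bool, Literature.Computability.Complexity.IsPolyTime f ∧
      ∃ ε : ℝ, 0 < ε ∧ ∃ᶠ n : ℕ in Filter.atTop, ∀ m : ℕ, m = ⌊α * n⌋₊ → ε ≤
        ((Finset.univ.filter fun Φ : Fin m → Fin k → Fin n × Bool => ∀ i, ∃ j,
          (f (Literature.Computability.Complexity.encodingCNF.encode (List.ofFn fun a =>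
            List.ofFn fun b => (((Φ a b).1 : ℕ), (Φ a b).2)))).getD (Φ i j).1 false =
              (Φ i j).2).card : ℝ) / Fintype.card (Fin m → Fin k → Fin n × Bool))
    (c : ℝ) (hc : 0 < c) :
    ∃ᶠ n : ℕ in Filter.atTop, ∀ m : ℕ, m = ⌊α * n⌋₊ →
      ∃ g : (Fin m → Fin k → Fin n × Bool) → (Fin n → Bool),
        Real.exp (-(c * n)) * Fintype.card (Fin (k + 1) → Fin m → Fin k → Fin n × Bool) ≤
        ((Finset.univ.filter fun Ψ : Fin (k + 1) → Fin m → Fin k → Fin n × Bool =>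
          let P : Fin k → ℕ → Fin m → Fin k → Fin n × Bool :=
            fun r q a b => if (a : ℕ) * k + b < q then Ψ r.succ a b else Ψ r.castSucc a b
          (∀ r : Fin k, ∀ q ≤ m * k, ((Finset.univ.filter fun i : Fin m =>
            ∀ j, g (P r q) (P r q i j).1 ≠ (P r q i j).2).card : ℝ) ≤ ν * m) ∧
          ∀ r : Fin k, ∀ q < m * k,
            (hammingDist (g (P r q)) (g (P r (q + 1))) : ℝ) ≤ η * n).card : ℝ) := by
  rcases hoff with hUC | hlog | hη1 | hνF | hνR
  · exact sissU_solvableImpliesStableSection_off_core k hk α η ν hα hη hν (Or.inl hUC) hsolv c hc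
  · exact sissU_solvableImpliesStableSection_off_core k hk α η ν hα hη hν (Or.inr (Or.inl hlog)) hsolv c hc
  · exact sissU_solvableImpliesStableSection_off_core k hk α η ν hα hη hν
      (Or.inr (Or.inr (Or.inl hη1))) hsolv c hc
  · exact (sissF_conclusion k (by omega) α η ν hα hη hνF c hc).frequently
  · exact sissU_solvableImpliesStableSection_off_core k hk α η ν hα hη hν
      (Or.inr (Or.inr (Or.inr (Or.inr hνR)))) hsolv c hc

/-- **The crux is equivalent to its new core.** `SolvableImpliesStableSection` holds iff it holds for
every `k ≥ 3` and `α, η, ν > 0` INSIDE the core region `2^k ≤ α·(k²-k)·2M_k` (`α ≥ α_UC(k)`),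
`α < 2^k log 2`, `η < 1`, `ν ≤ 2^{-k}(1 - e^{-kα2^{-k}}/2)`, `ν ≤ 2^{-k}(e^{kα2^{-k}} - 1)`; off the core it
is the theorem `sissF_solvableImpliesStableSection_off_core`. -/
theorem sissF_solvableImpliesStableSection_iff_core :
    Summit.PneNP.PneNP.Theses.OverlapGapAlgebra.SolvableImpliesStableSection ↔
    (∀ k : ℕ, 3 ≤ k → ∀ α η ν : ℝ, 0 < α → 0 < η → 0 < ν →
      (2 : ℝ) ^ k ≤ α * ((k * k - k : ℕ) : ℝ) * (2 * (((k : ℝ) - 2) ^ (k - 2) / ((k : ℝ) - 1) ^ (k - 1))) →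
      α < (2 : ℝ) ^ k * Real.log 2 → η < 1 →
      ν ≤ (1 / 2 : ℝ) ^ k * (1 - Real.exp (-(k * α * (1 / 2 : ℝ) ^ k)) / 2) →
      ν ≤ (1 / 2 : ℝ) ^ k * (Real.exp (k * α * (1 / 2 : ℝ) ^ k) - 1) →
      (∃ f : List Bool → List Bool, Literature.Computability.Complexity.IsPolyTime f ∧ ∃ ε : ℝ, 0 < ε ∧ ∃ᶠ n : ℕ in Filter.atTop, ∀ m : ℕ, m = ⌊α * n⌋₊ → ε ≤ ((Finset.univ.filter fun Φ : Fin m → Fin k → Fin n × Bool => ∀ i, ∃ j, (f (Literature.Computability.Complexity.encodingCNF.encode (List.ofFn fun a => List.ofFn fun b => (((Φ a b).1 : ℕ), (Φ a b).2)))).getD (Φ i j).1 false = (Φ i j).2).card : ℝ) / Fintype.card (Fin m → Fin k → Fin n × Bool)) →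
      ∀ c : ℝ, 0 < c → ∃ᶠ n : ℕ in Filter.atTop, ∀ m : ℕ, m = ⌊α * n⌋₊ → ∃ g : (Fin m → Fin k → Fin n × Bool) → (Fin n → Bool), Real.exp (-(c * n)) * Fintype.card (Fin (k + 1) → Fin m → Fin k → Fin n × Bool) ≤ ((Finset.univ.filter fun Ψ : Fin (k + 1) → Fin m → Fin k → Fin n × Bool => let P : Fin k → ℕ → Fin m → Fin k → Fin n × Bool := fun r q a b => if (a : ℕ) * k + b < q then Ψ r.succ a b else Ψ r.castSucc a b; (∀ r : Fin k, ∀ q ≤ m * k, ((Finset.univ.filter fun i : Fin m => ∀ j, g (P r q) (P r q i j).1 ≠ (P r q i j).2).card : ℝ) ≤ ν * m) ∧ ∀ r : Fin k, ∀ q < m * k, (hammingDist (g (P r q)) (g (P r (q + 1))) : ℝ) ≤ η * n).card : ℝ)) := by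
  constructor
  · intro h k hk α η ν hα hη hν _ _ _ _ _ hsolv c hc
    exact h k hk α η ν hα hη hν hsolv c hc
  · intro hcore
    unfold Summit.PneNP.PneNP.Theses.OverlapGapAlgebra.SolvableImpliesStableSection
    intro k hk α η ν hα hη hν hsolv c hc
    by_cases h1 : (2 : ℝ) ^ k ≤ α * ((k * k - k : ℕ) : ℝ) * (2 * (((k : ℝ) - 2) ^ (k - 2) / ((k : ℝ) - 1) ^ (k - 1)))
    · by_cases h2 : α < (2 : ℝ) ^ k * Real.log 2
      · by_cases h3 : η < 1
        · by_cases h4 : ν ≤ (1 / 2 : ℝ) ^ k * (1 - Real.exp (-(k * α * (1 / 2 : ℝ) ^ k)) / 2)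
          · by_cases h5 : ν ≤ (1 / 2 : ℝ) ^ k * (Real.exp (k * α * (1 / 2 : ℝ) ^ k) - 1)
            · exact hcore k hk α η ν hα hη hν h1 h2 h3 h4 h5 hsolv c hc
            · exact sissF_solvableImpliesStableSection_off_core k hk α η ν hα hη hν
                (Or.inr (Or.inr (Or.inr (Or.inr (not_le.1 h5))))) hsolv c hc
          · exact sissF_solvableImpliesStableSection_off_core k hk α η ν hα hη hν
              (Or.inr (Or.inr (Or.inr (Or.inl (not_le.1 h4))))) hsolv c hc
        · exact sissF_solvableImpliesStableSection_off_core k hk α η ν hα hη hν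
            (Or.inr (Or.inr (Or.inl (not_lt.1 h3)))) hsolv c hc
      · exact sissF_solvableImpliesStableSection_off_core k hk α η ν hα hη hν
          (Or.inr (Or.inl (not_lt.1 h2))) hsolv c hc
    · exact sissF_solvableImpliesStableSection_off_core k hk α η ν hα hη hν
        (Or.inl (not_le.1 h1)) hsolv c hc

end FilteredRepairAssembly

end Summit.PneNP.PneNP.Theorems
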